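import Mathlib.NumberTheory.ModularForms.CongruenceSubgroups
import HarnessLib

/-!
# Crux `ThetaLayerLambdaCongruenceAtTwo` (stmt-BirchSwinnertonDyer-20688, route ResidualThetaTransportAtTwo), line
# `birth`, stub (C3) `stub_plusLineAtTwo` — ITEM A, part 1: the PERIOD HOMOMORPHISM `γ ↦ Φ(γ·∞)` of a
# Γ₀(N)-symbol function (lead prover bsd-wall-rtt-p3 g3; `--supports stmt-BirchSwinnertonDyer-20688 --as helper`;
# closes nothing)

HONEST FRAMING. Elementary THEOREMS about functions `Φ : ℚ → R` only; nothing about any curve or form is asserted;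
BSD is not proved by any of this. This is piece (P1/P2-light) of the formalisation plan
`Cruxes/ThetaLayerLambdaCongruenceAtTwo/Lines/birth-C3-plan.md` for the plus-line stub (C3) of line `birth`
(«plus multiplicity one mod 2 for depleted Γ₀(N')-symbol functions», skeleton v7); companion file
`…ThetaLayerLambdaCongruenceAtTwoTwoExclusion` (T₂-exclusion of boundary symbols).

WHAT. A Γ₀(N)-SYMBOL FUNCTION (weight 2, trivial coefficients) is `Φ : ℚ → R`, `R` an additive group, with Manin's
relation `Φ(γ·r) = Φ(γ·∞) + Φ(r)` for `γ ∈ Γ₀(N)`, `r ∈ ℚ`, `γ·r ≠ ∞` (cusp value `Φ(γ·∞) := Φ(a/c)`, read as `0` when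
`c = 0`) — written INLINE in the exact shape of the tree's `modularSymbol_gamma0_smul` and of (C3); no definition is
introduced. Equivalently `Φ` is a `Γ₀(N)`-invariant homomorphism on degree-`0` divisors of `P¹(ℚ)` read on
`(r) − (∞)` ([Manin1972] §1.5; Ash–Stevens' `Symb_Γ(R) = Hom_Γ(Δ₀, R)`). THE PERIOD MAP `γ ↦ Φ(γ·∞)`:
* `maninCusp_neg_div`: `Φ(γ⁻¹·∞) = −Φ(γ·∞)`, i.e. `Φ(−d/c) = −Φ(a/c)`;
* `maninCusp_mul`: it is a HOMOMORPHISM `Γ₀(N) → R`, `Φ((γδ)·∞) = Φ(γ·∞) + Φ(δ·∞)`;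
* `maninCusp_eq_zero_of_fixed`: it kills every element fixing a rational point (parabolic stabilisers of cusps);
* `sub_mem_of_maninCusp_mem` / `maninCusp_mem_of_sub_mem`: modulo any subgroup `S ≤ R`, `Φ` is `Γ₀(N)`-INVARIANT
  mod `S` (a boundary symbol mod `S`) iff all its cusp values lie in `S`.
This is the map `Symb_Γ(R) → H¹(Γ, R)` of the long exact sequence of `0 → Δ₀ → ℤ[P¹(ℚ)] → ℤ → 0`, whose kernel is
the boundary (Eisenstein) part `Hom(ℤ[cusps]⁰, R)`; for (C3) with `R = k̄` of characteristic `2` its image lies in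
the homomorphisms `Γ₀(N') → k̄` killing parabolics (and order-`3` torsion) — NOT necessarily the order-`2` elliptic
elements (the `ℓ = 2` caveat of the plan, (P2)).
NOT here: Hecke equivariance of the period map; evenness; anything about `H₁(X₀(N'))`.

References: [Manin1972] §1.5–1.7, Thm. 1.9; [CremonaAlgorithms1997] §2.2, §2.8; [Merel1994] §1.2.
-/

noncomputable section

-- justification: the `Summit.BirchSwinnertonDyer.BirchSwinnertonDyer.…` path repeats a component (route-file convention)
set_option linter.dupNamespace false

open scoped Classical MatrixGroups

open CongruenceSubgroup

namespace Summit.BirchSwinnertonDyer.BirchSwinnertonDyer.Theorems.ThetaLayerLambdaCongruenceAtTwo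

/-! ## §1. The period homomorphism `γ ↦ Φ(γ·∞)` of a Γ₀(N)-symbol function -/

section PeriodHom

variable {R : Type*} [AddCommGroup R] {N : ℕ} {Φ : ℚ → R}

/-- For a Γ₀(N)-symbol function `Φ` and `γ = (a,b;c,d) ∈ Γ₀(N)` with `c ≠ 0`: `Φ(−d/c) = −Φ(a/c)`, i.e.
`Φ(γ⁻¹·∞) = −Φ(γ·∞)` (Manin's relation at `(γ, r)` and at `(γ⁻¹, γ·r)` for `r = (1 − d)/c`, where `cr + d = 1`).
[cite: Manin1972, §1.5 and Thm. 1.9] -/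
theorem maninCusp_neg_div
    (hM : ∀ (γ : Gamma0 N) (r : ℚ), ((γ : SL(2, ℤ)) 1 0 : ℚ) * r + ((γ : SL(2, ℤ)) 1 1 : ℚ) ≠ 0 →
      Φ ((((γ : SL(2, ℤ)) 0 0 : ℚ) * r + ((γ : SL(2, ℤ)) 0 1 : ℚ)) /
        (((γ : SL(2, ℤ)) 1 0 : ℚ) * r + ((γ : SL(2, ℤ)) 1 1 : ℚ))) =
        (if ((γ : SL(2, ℤ)) 1 0) = 0 then 0 else Φ ((((γ : SL(2, ℤ)) 0 0 : ℚ)) / (((γ : SL(2, ℤ)) 1 0 : ℚ)))) + Φ r)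
    (γ : Gamma0 N) (hc : (γ : SL(2, ℤ)) 1 0 ≠ 0) :
    Φ (-(((γ : SL(2, ℤ)) 1 1 : ℚ)) / ((γ : SL(2, ℤ)) 1 0 : ℚ)) = -Φ (((γ : SL(2, ℤ)) 0 0 : ℚ) / ((γ : SL(2, ℤ)) 1 0 : ℚ)) := by
  set a : ℤ := (γ : SL(2, ℤ)) 0 0 with ha
  set b : ℤ := (γ : SL(2, ℤ)) 0 1 with hb
  set c : ℤ := (γ : SL(2, ℤ)) 1 0 with hc'
  set d : ℤ := (γ : SL(2, ℤ)) 1 1 with hd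
  have hdet : a * d - b * c = 1 := by
    have := Matrix.det_fin_two (γ : SL(2, ℤ)).1
    rw [(γ : SL(2, ℤ)).2] at this
    linear_combination -this
  have hdetQ : (a : ℚ) * d - b * c = 1 := by exact_mod_cast hdet
  have hcQ : (c : ℚ) ≠ 0 := by exact_mod_cast hc
  -- the point `r = (1 - d)/c`, with `c r + d = 1`
  set r : ℚ := (1 - (d : ℚ)) / c with hr
  have hcr : (c : ℚ) * r + d = 1 := by rw [hr]; field_simp; ring
  have h1 := hM γ r (by rw [hcr]; exact one_ne_zero)
  rw [if_neg hc, hcr, div_one] at h1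
  rw [← ha, ← hb, ← hc'] at h1
  -- Manin at `(γ⁻¹, γ·r)`: the entries of `γ⁻¹` are `(d, -b; -c, a)`
  have hi00 : (((γ⁻¹ : Gamma0 N) : SL(2, ℤ)) 0 0) = d := by
    simp [Matrix.SpecialLinearGroup.SL2_inv_expl, hd]
  have hi01 : (((γ⁻¹ : Gamma0 N) : SL(2, ℤ)) 0 1) = -b := by
    simp [Matrix.SpecialLinearGroup.SL2_inv_expl, hb]
  have hi10 : (((γ⁻¹ : Gamma0 N) : SL(2, ℤ)) 1 0) = -c := by
    simp [Matrix.SpecialLinearGroup.SL2_inv_expl, hc']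
  have hi11 : (((γ⁻¹ : Gamma0 N) : SL(2, ℤ)) 1 1) = a := by
    simp [Matrix.SpecialLinearGroup.SL2_inv_expl, ha]
  have h2 := hM γ⁻¹ ((a : ℚ) * r + b)
  rw [hi00, hi01, hi10, hi11] at h2
  have hcr' : (c : ℚ) * r = 1 - d := eq_sub_of_add_eq hcr
  have hden : ((-c : ℤ) : ℚ) * ((a : ℚ) * r + b) + (a : ℚ) = 1 := by
    push_cast
    linear_combination (-(a : ℚ)) * hcr' + hdetQ
  have h2 := h2 (by rw [hden]; exact one_ne_zero)
  rw [hden, div_one, if_neg (neg_ne_zero.mpr hc)] at h2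
  have eback : ((d : ℤ) : ℚ) * ((a : ℚ) * r + b) + ((-b : ℤ) : ℚ) = r := by
    push_cast
    linear_combination (b : ℚ) * hcr + r * hdetQ
  rw [eback] at h2
  have ecusp : (((d : ℤ) : ℚ)) / (((-c : ℤ) : ℚ)) = -((d : ℚ)) / (c : ℚ) := by
    push_cast; rw [div_neg, neg_div]
  rw [ecusp] at h2
  -- `h1 : Φ (a r + b) = Φ (a/c) + Φ r`, `h2 : Φ r = Φ (-d/c) + Φ (a r + b)`
  have h3 : Φ (-(d : ℚ) / c) + Φ ((a : ℚ) / c) + Φ r = 0 + Φ r := by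
    rw [zero_add, add_assoc, ← h1]; exact h2.symm
  exact eq_neg_of_add_eq_zero_left (add_right_cancel h3)

/-- **The period map is a homomorphism**: for a Γ₀(N)-symbol function `Φ`, `Φ((γδ)·∞) = Φ(γ·∞) + Φ(δ·∞)`
(cusp values `Φ(a/c)`, read as `0` when `c = 0`). Cases: `δ·∞ = ∞`; `δ·∞ = x ∈ ℚ` with `γ·x ≠ ∞` (Manin's relation
at `(γ, x)`); `γ·x = ∞`, i.e. `x = γ⁻¹·∞` (`maninCusp_neg_div`). [cite: Manin1972, §1.5 and Thm. 1.9] -/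
theorem maninCusp_mul
    (hM : ∀ (γ : Gamma0 N) (r : ℚ), ((γ : SL(2, ℤ)) 1 0 : ℚ) * r + ((γ : SL(2, ℤ)) 1 1 : ℚ) ≠ 0 →
      Φ ((((γ : SL(2, ℤ)) 0 0 : ℚ) * r + ((γ : SL(2, ℤ)) 0 1 : ℚ)) /
        (((γ : SL(2, ℤ)) 1 0 : ℚ) * r + ((γ : SL(2, ℤ)) 1 1 : ℚ))) =
        (if ((γ : SL(2, ℤ)) 1 0) = 0 then 0 else Φ ((((γ : SL(2, ℤ)) 0 0 : ℚ)) / (((γ : SL(2, ℤ)) 1 0 : ℚ)))) + Φ r)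
    (γ δ : Gamma0 N) :
    (if (((γ * δ : Gamma0 N) : SL(2, ℤ)) 1 0) = 0 then 0
      else Φ (((((γ * δ : Gamma0 N) : SL(2, ℤ)) 0 0 : ℚ)) / ((((γ * δ : Gamma0 N) : SL(2, ℤ)) 1 0 : ℚ)))) =
      (if ((γ : SL(2, ℤ)) 1 0) = 0 then 0 else Φ ((((γ : SL(2, ℤ)) 0 0 : ℚ)) / (((γ : SL(2, ℤ)) 1 0 : ℚ)))) +
        (if ((δ : SL(2, ℤ)) 1 0) = 0 then 0 else Φ ((((δ : SL(2, ℤ)) 0 0 : ℚ)) / (((δ : SL(2, ℤ)) 1 0 : ℚ)))) := by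
  have hneg := fun hc ↦ maninCusp_neg_div hM γ hc
  have hMγ := hM γ
  set a : ℤ := (γ : SL(2, ℤ)) 0 0 with ha
  set b : ℤ := (γ : SL(2, ℤ)) 0 1 with hb
  set c : ℤ := (γ : SL(2, ℤ)) 1 0 with hc'
  set d : ℤ := (γ : SL(2, ℤ)) 1 1 with hd
  set a' : ℤ := (δ : SL(2, ℤ)) 0 0 with ha'
  set b' : ℤ := (δ : SL(2, ℤ)) 0 1 with hb'
  set c' : ℤ := (δ : SL(2, ℤ)) 1 0 with hc''
  set d' : ℤ := (δ : SL(2, ℤ)) 1 1 with hd'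
  have hdet : a * d - b * c = 1 := by
    have := Matrix.det_fin_two (γ : SL(2, ℤ)).1
    rw [(γ : SL(2, ℤ)).2] at this
    linear_combination -this
  have hdet' : a' * d' - b' * c' = 1 := by
    have := Matrix.det_fin_two (δ : SL(2, ℤ)).1
    rw [(δ : SL(2, ℤ)).2] at this
    linear_combination -this
  have e00 : (((γ * δ : Gamma0 N) : SL(2, ℤ)) 0 0) = a * a' + b * c' :=
    (Matrix.two_mul_expl ((γ : SL(2, ℤ)) : Matrix (Fin 2) (Fin 2) ℤ) ((δ : SL(2, ℤ)) : Matrix (Fin 2) (Fin 2) ℤ)).1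
  have e10 : (((γ * δ : Gamma0 N) : SL(2, ℤ)) 1 0) = c * a' + d * c' :=
    (Matrix.two_mul_expl ((γ : SL(2, ℤ)) : Matrix (Fin 2) (Fin 2) ℤ)
      ((δ : SL(2, ℤ)) : Matrix (Fin 2) (Fin 2) ℤ)).2.2.1
  rw [e00, e10]
  by_cases h0 : c' = 0
  · -- `δ·∞ = ∞`
    have had : a' * d' = 1 := by rw [h0, mul_zero, sub_zero] at hdet'; exact hdet'
    have ha'0 : a' ≠ 0 := left_ne_zero_of_mul_eq_one had
    rw [if_pos h0, add_zero, h0, mul_zero, add_zero, mul_zero, add_zero]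
    by_cases hc : c = 0
    · rw [if_pos (by rw [hc, zero_mul]), if_pos hc]
    · rw [if_neg (mul_ne_zero hc ha'0), if_neg hc]
      congr 1
      have : (a' : ℚ) ≠ 0 := by exact_mod_cast ha'0
      push_cast
      rw [mul_div_mul_right _ _ this]
  · -- `δ·∞ = x = a'/c' ∈ ℚ`
    have hc'Q : (c' : ℚ) ≠ 0 := by exact_mod_cast h0
    rw [if_neg h0]
    by_cases hx : (c : ℚ) * ((a' : ℚ) / c') + d = 0
    · -- `γ·x = ∞`: then `c ≠ 0`, `x = -d/c = γ⁻¹·∞`, and `(γδ)·∞ = ∞`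
      have hc : c ≠ 0 := by
        rintro h
        rw [h, Int.cast_zero, zero_mul, zero_add] at hx
        have hd0 : d = 0 := by exact_mod_cast hx
        rw [h, hd0, mul_zero, mul_zero, sub_zero] at hdet
        exact zero_ne_one hdet
      have hcQ : (c : ℚ) ≠ 0 := by exact_mod_cast hc
      have h10 : c * a' + d * c' = 0 := by
        have h : ((c : ℚ) * ((a' : ℚ) / c') + d) * c' = 0 := by rw [hx, zero_mul]
        have h' : (c : ℚ) * a' + d * c' = 0 := by
          rw [← h]; field_simp
        exact_mod_cast h'
      rw [if_pos h10, if_neg hc]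
      have ex : ((a' : ℚ) / c') = -(d : ℚ) / c := by
        field_simp
        have h' : (c : ℚ) * a' + d * c' = 0 := by exact_mod_cast h10
        linear_combination h'
      rw [ex, hneg hc, add_neg_cancel]
    · -- generic case: Manin's relation at `(γ, x)`
      have h := hMγ ((a' : ℚ) / c') hx
      have h10Q : ((c * a' + d * c' : ℤ) : ℚ) ≠ 0 := by
        push_cast
        intro h'
        apply hx
        have : ((c : ℚ) * ((a' : ℚ) / c') + d) * c' = 0 := by rw [← h']; field_simp
        simpa [hc'Q] using this
      have h10 : c * a' + d * c' ≠ 0 := by exact_mod_cast h10Q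
      rw [if_neg h10, ← h]
      congr 1
      push_cast
      field_simp

/-- The period homomorphism **kills every element fixing a rational point**: if `γ ∈ Γ₀(N)` fixes `x ∈ ℚ`
(`γ·x = x`, `γ·x ≠ ∞`) — e.g. `γ` in the (parabolic) stabiliser of the cusp `x` — then `Φ(γ·∞) = 0` (Manin's
relation at `(γ, x)`). For `γ` fixing `∞` (`c = 0`) the cusp value is `0` by convention.
[cite: Manin1972, §1.5 and Thm. 1.9] -/
theorem maninCusp_eq_zero_of_fixed
    (hM : ∀ (γ : Gamma0 N) (r : ℚ), ((γ : SL(2, ℤ)) 1 0 : ℚ) * r + ((γ : SL(2, ℤ)) 1 1 : ℚ) ≠ 0 →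
      Φ ((((γ : SL(2, ℤ)) 0 0 : ℚ) * r + ((γ : SL(2, ℤ)) 0 1 : ℚ)) /
        (((γ : SL(2, ℤ)) 1 0 : ℚ) * r + ((γ : SL(2, ℤ)) 1 1 : ℚ))) =
        (if ((γ : SL(2, ℤ)) 1 0) = 0 then 0 else Φ ((((γ : SL(2, ℤ)) 0 0 : ℚ)) / (((γ : SL(2, ℤ)) 1 0 : ℚ)))) + Φ r)
    (γ : Gamma0 N) (x : ℚ) (hx : ((γ : SL(2, ℤ)) 1 0 : ℚ) * x + ((γ : SL(2, ℤ)) 1 1 : ℚ) ≠ 0)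
    (hfix : (((γ : SL(2, ℤ)) 0 0 : ℚ) * x + ((γ : SL(2, ℤ)) 0 1 : ℚ)) /
        (((γ : SL(2, ℤ)) 1 0 : ℚ) * x + ((γ : SL(2, ℤ)) 1 1 : ℚ)) = x) :
    (if ((γ : SL(2, ℤ)) 1 0) = 0 then 0 else Φ ((((γ : SL(2, ℤ)) 0 0 : ℚ)) / (((γ : SL(2, ℤ)) 1 0 : ℚ)))) = 0 := by
  have h := hM γ x hx
  rw [hfix] at h
  have h' : (if ((γ : SL(2, ℤ)) 1 0) = 0 then 0 else Φ ((((γ : SL(2, ℤ)) 0 0 : ℚ)) / (((γ : SL(2, ℤ)) 1 0 : ℚ)))) +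
      Φ x = 0 + Φ x := by rw [zero_add]; exact h.symm
  exact add_right_cancel h'

/-- A symbol function all of whose cusp values lie in a subgroup `S ≤ R` is `Γ₀(N)`-INVARIANT modulo `S`:
`Φ(γ·r) − Φ(r) = Φ(γ·∞) ∈ S`. (With `S = 0`: boundary symbols are the `Γ₀(N)`-invariant functions; with `S = 𝔪`:
an eigen-symbol whose period homomorphism vanishes mod `𝔪` is a boundary symbol mod `𝔪`.)
[cite: Manin1972, §1.5 and Thm. 1.9] -/
theorem sub_mem_of_maninCusp_mem (S : AddSubgroup R)
    (hM : ∀ (γ : Gamma0 N) (r : ℚ), ((γ : SL(2, ℤ)) 1 0 : ℚ) * r + ((γ : SL(2, ℤ)) 1 1 : ℚ) ≠ 0 →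
      Φ ((((γ : SL(2, ℤ)) 0 0 : ℚ) * r + ((γ : SL(2, ℤ)) 0 1 : ℚ)) /
        (((γ : SL(2, ℤ)) 1 0 : ℚ) * r + ((γ : SL(2, ℤ)) 1 1 : ℚ))) =
        (if ((γ : SL(2, ℤ)) 1 0) = 0 then 0 else Φ ((((γ : SL(2, ℤ)) 0 0 : ℚ)) / (((γ : SL(2, ℤ)) 1 0 : ℚ)))) + Φ r)
    (hcusp : ∀ γ : Gamma0 N, (γ : SL(2, ℤ)) 1 0 ≠ 0 →
      Φ ((((γ : SL(2, ℤ)) 0 0 : ℚ)) / (((γ : SL(2, ℤ)) 1 0 : ℚ))) ∈ S) :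
    ∀ (γ : Gamma0 N) (r : ℚ), ((γ : SL(2, ℤ)) 1 0 : ℚ) * r + ((γ : SL(2, ℤ)) 1 1 : ℚ) ≠ 0 →
      Φ ((((γ : SL(2, ℤ)) 0 0 : ℚ) * r + ((γ : SL(2, ℤ)) 0 1 : ℚ)) /
        (((γ : SL(2, ℤ)) 1 0 : ℚ) * r + ((γ : SL(2, ℤ)) 1 1 : ℚ))) - Φ r ∈ S := by
  intro γ r hr
  rw [hM γ r hr, add_sub_cancel_right]
  by_cases hc : (γ : SL(2, ℤ)) 1 0 = 0
  · rw [if_pos hc]; exact S.zero_mem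
  · rw [if_neg hc]; exact hcusp γ hc

/-- Conversely, a symbol function that is `Γ₀(N)`-invariant modulo `S` has all its cusp values in `S`
(`Φ(γ·∞) = Φ(γ·r) − Φ(r)` at `r = (1 − d)/c`). [cite: Manin1972, §1.5 and Thm. 1.9] -/
theorem maninCusp_mem_of_sub_mem (S : AddSubgroup R)
    (hM : ∀ (γ : Gamma0 N) (r : ℚ), ((γ : SL(2, ℤ)) 1 0 : ℚ) * r + ((γ : SL(2, ℤ)) 1 1 : ℚ) ≠ 0 →
      Φ ((((γ : SL(2, ℤ)) 0 0 : ℚ) * r + ((γ : SL(2, ℤ)) 0 1 : ℚ)) /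
        (((γ : SL(2, ℤ)) 1 0 : ℚ) * r + ((γ : SL(2, ℤ)) 1 1 : ℚ))) =
        (if ((γ : SL(2, ℤ)) 1 0) = 0 then 0 else Φ ((((γ : SL(2, ℤ)) 0 0 : ℚ)) / (((γ : SL(2, ℤ)) 1 0 : ℚ)))) + Φ r)
    (hinv : ∀ (γ : Gamma0 N) (r : ℚ), ((γ : SL(2, ℤ)) 1 0 : ℚ) * r + ((γ : SL(2, ℤ)) 1 1 : ℚ) ≠ 0 →
      Φ ((((γ : SL(2, ℤ)) 0 0 : ℚ) * r + ((γ : SL(2, ℤ)) 0 1 : ℚ)) /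
        (((γ : SL(2, ℤ)) 1 0 : ℚ) * r + ((γ : SL(2, ℤ)) 1 1 : ℚ))) - Φ r ∈ S) :
    ∀ γ : Gamma0 N, (γ : SL(2, ℤ)) 1 0 ≠ 0 →
      Φ ((((γ : SL(2, ℤ)) 0 0 : ℚ)) / (((γ : SL(2, ℤ)) 1 0 : ℚ))) ∈ S := by
  intro γ hc
  have hcQ : ((γ : SL(2, ℤ)) 1 0 : ℚ) ≠ 0 := by exact_mod_cast hc
  set r : ℚ := (1 - ((γ : SL(2, ℤ)) 1 1 : ℚ)) / ((γ : SL(2, ℤ)) 1 0 : ℚ) with hr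
  have hcr : ((γ : SL(2, ℤ)) 1 0 : ℚ) * r + ((γ : SL(2, ℤ)) 1 1 : ℚ) = 1 := by rw [hr]; field_simp; ring
  have h1 := hM γ r (by rw [hcr]; exact one_ne_zero)
  have h2 := hinv γ r (by rw [hcr]; exact one_ne_zero)
  rw [h1, if_neg hc, add_sub_cancel_right] at h2
  exact h2

end PeriodHom

end Summit.BirchSwinnertonDyer.BirchSwinnertonDyer.Theorems.ThetaLayerLambdaCongruenceAtTwo

end
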